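import Summits.CriticalPhenomena.PercolationContinuityZ3.Theorems.PercNearOneGluingNoHeavyLowerTailFKHullPortTASDefs
import Summits.CriticalPhenomena.PercolationContinuityZ3.Theorems.PercNearOneGluingNoHeavyLowerTailFKHullPortTASections
import HarnessLib

/-!
# FK sub-lane: section identities for the owner-set `T^S` functionals of `φ_{𝐩,q}`

Support file (`--supports stmt-CriticalPhenomena-4575`), FK sub-lane `prim-bschramm-fk-2` (gen 3); builds on p205010 (kernel theorem,
internal audit signed; external expert review pending).  No definitions, no named facts, no sorries; standard axioms.

The owner-set copies of `…FKHullPortTASections.lean` (this cell): locality of the world functionals `FK.taCS/taNS/taNWS` in the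
parameters off the cut set, ABSORPTION (a parameter-`1` pair `s(x₀,v)` at `X` lets `v` join the avoided set for free) and the
one-coordinate SECTION identities `F_X(w) = (1 − w e)·F_X(w[e↦0]) + (w e)·F_{X∪{v}}(w[e↦1])` for `F ∈ {taBS, taAS, tabS, taaS}`
(deletion / contraction of `e = s(x₀,v)`, `x₀ ∈ X`; Grimmett (3.1)(a) in the weights (1.20)).  In this file the observer is called
`y` and the marker `z` (the `T^S` dictionary is `(x, S, v, o)` = owner, owner set, observer, marker).  bschramm/FK-Q2.md §12.6(c).
[cite: Grimmett2006, §1.4 eq. (1.20) (p. 15), Thm. (3.1)(a)] [cite: VandenbergHaggstromKahn2005, §2.1 Lemma 2.3 (p. 10)]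
-/

noncomputable section

namespace Summit.CriticalPhenomena.PercolationContinuityZ3.Theorems.FK

open MeasureTheory Set Literature.Probability.LatticeModels Literature.Probability.Percolation
open Literature.Probability.Percolation.DecisionTree (ind ind_of_mem ind_of_not_mem)
open Literature.Probability.Percolation.BHK2006 (rcMass delW)
open Summit.CriticalPhenomena.PercolationContinuityZ3.Theorems.HullPort (cut avoidEv connS insert_mem_avoidEv_iff cut_insert_edge
  edge_mem_cut)
open scoped Classical

variable {V : Type*} [Fintype V]

/-- `c^S` does not see the parameters of the cut pairs. [cite: VandenbergHaggstromKahn2005, §2.1 Lemma 2.3 (p. 10)] -/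
theorem taCS_congr_off {w w' : Sym2 V → unitInterval} (q : ℝ) (x : V) (S : Set V) (v : V) (X : Set V) (g : Set (Sym2 V) → ℝ)
    {ω : Set (Sym2 V)} (h : ∀ e ∉ cut X ω, w e = w' e) : taCS w q x S v X g ω = taCS w' q x S v X g ω := by
  unfold taCS
  rw [wE_congr_off q h, wE_congr_off q h, wE_congr_off q h]

/-- `taNS` does not see the parameters of the cut pairs. [cite: VandenbergHaggstromKahn2005, §2.1 Lemma 2.3 (p. 10)] -/
theorem taNS_congr_off {w w' : Sym2 V → unitInterval} (q : ℝ) (S : Set V) (v : V) (X : Set V)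
    {ω : Set (Sym2 V)} (h : ∀ e ∉ cut X ω, w e = w' e) : taNS w q S v X ω = taNS w' q S v X ω := by
  unfold taNS
  rw [wE_congr_off q h]

/-- `taNWS` does not see the parameters of the cut pairs. [cite: VandenbergHaggstromKahn2005, §2.1 Lemma 2.3 (p. 10)] -/
theorem taNWS_congr_off {w w' : Sym2 V → unitInterval} (q : ℝ) (S : Set V) (v o : V) (X : Set V)
    {ω : Set (Sym2 V)} (h : ∀ e ∉ cut X ω, w e = w' e) : taNWS w q S v o X ω = taNWS w' q S v o X ω := by
  unfold taNWS
  rw [wE_congr_off q h]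

/-- **Absorption**: if the pair `e = s(x₀,v)` (`x₀ ∈ X`) has parameter `1`, adding `v` to the avoided set changes nothing in `B`
(configurations with `e` closed have weight `0`; with `e` open the cut set and the avoidance of `X ∪ {v}` are those of `X`).
[cite: Grimmett2006, §1.4 eq. (1.20) (p. 15)] -/
theorem taBS_absorb (w : Sym2 V → unitInterval) (q : ℝ) (x : V) (S : Set V) (y x₀ v : V) (X : Set V) (hx₀ : x₀ ∈ X)
    (h1 : (w s(x₀, v) : ℝ) = 1) (g : Set (Sym2 V) → ℝ) : taBS w q x S y (insert v X) g = taBS w q x S y X g := by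
  unfold taBS
  refine Finset.sum_congr rfl fun ω _ => ?_
  by_cases he : s(x₀, v) ∈ ω
  · have hω : insert s(x₀, v) ω = ω := Set.insert_eq_of_mem he
    have hcut : cut (insert v X) ω = cut X ω := by rw [← cut_insert_edge x₀ v X hx₀ ω, hω]
    have hav : ind (avoidEv x (insert v X)) ω = ind (avoidEv x X) ω := by
      by_cases h : ω ∈ avoidEv x (insert v X)
      · rw [ind_of_mem h, ind_of_mem (hω ▸ (insert_mem_avoidEv_iff x x₀ v X hx₀ ω).2 h)]
      · rw [ind_of_not_mem h, ind_of_not_mem fun h' => h ((insert_mem_avoidEv_iff x x₀ v X hx₀ ω).1 (hω.symm ▸ h'))]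
    have hC : taCS w q x S y (insert v X) g ω = taCS w q x S y X g ω := by
      unfold taCS; rw [hcut]
    rw [hav, hC]
  · rw [rcWeightW_eq_zero_of_one_not_mem w q ∅ h1 he, zero_mul, zero_mul]

/-- Absorption for `A`. [cite: Grimmett2006, §1.4 eq. (1.20) (p. 15)] -/
theorem taAS_absorb (w : Sym2 V → unitInterval) (q : ℝ) (x : V) (S : Set V) (y z x₀ v : V) (X : Set V) (hx₀ : x₀ ∈ X)
    (h1 : (w s(x₀, v) : ℝ) = 1) (g : Set (Sym2 V) → ℝ) : taAS w q x S y z (insert v X) g = taAS w q x S y z X g := by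
  unfold taAS
  refine Finset.sum_congr rfl fun ω _ => ?_
  by_cases he : s(x₀, v) ∈ ω
  · have hω : insert s(x₀, v) ω = ω := Set.insert_eq_of_mem he
    have hcut : cut (insert v X) ω = cut X ω := by rw [← cut_insert_edge x₀ v X hx₀ ω, hω]
    have hav : ind (avoidEv x (insert v X)) ω = ind (avoidEv x X) ω := by
      by_cases h : ω ∈ avoidEv x (insert v X)
      · rw [ind_of_mem h, ind_of_mem (hω ▸ (insert_mem_avoidEv_iff x x₀ v X hx₀ ω).2 h)]
      · rw [ind_of_not_mem h, ind_of_not_mem fun h' => h ((insert_mem_avoidEv_iff x x₀ v X hx₀ ω).1 (hω.symm ▸ h'))]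
    have hC : taCS w q x S y (insert v X) g ω = taCS w q x S y X g ω := by unfold taCS; rw [hcut]
    have hN : taNS w q S y (insert v X) ω = taNS w q S y X ω := by unfold taNS; rw [hcut]
    have hNW : taNWS w q S y z (insert v X) ω = taNWS w q S y z X ω := by unfold taNWS; rw [hcut]
    rw [hav, hC, hN, hNW]
  · rw [rcWeightW_eq_zero_of_one_not_mem w q ∅ h1 he, zero_mul, zero_mul]

/-- Absorption for `b`. [cite: Grimmett2006, §1.4 eq. (1.20) (p. 15)] -/
theorem tabS_absorb (w : Sym2 V → unitInterval) (q : ℝ) (S : Set V) (y x₀ v : V) (X : Set V) (hx₀ : x₀ ∈ X)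
    (h1 : (w s(x₀, v) : ℝ) = 1) : tabS w q S y (insert v X) = tabS w q S y X := by
  unfold tabS
  refine Finset.sum_congr rfl fun ω _ => ?_
  by_cases he : s(x₀, v) ∈ ω
  · have hω : insert s(x₀, v) ω = ω := Set.insert_eq_of_mem he
    have hx₀' : x₀ ∈ S ∪ X := Set.mem_union_right _ hx₀
    have hav : ind (avoidEv y (S ∪ insert v X)) ω = ind (avoidEv y (S ∪ X)) ω := by
      rw [Set.union_insert]
      by_cases h : ω ∈ avoidEv y (insert v (S ∪ X))
      · rw [ind_of_mem h, ind_of_mem (hω ▸ (insert_mem_avoidEv_iff y x₀ v (S ∪ X) hx₀' ω).2 h)]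
      · rw [ind_of_not_mem h, ind_of_not_mem fun h' =>
          h ((insert_mem_avoidEv_iff y x₀ v (S ∪ X) hx₀' ω).1 (hω.symm ▸ h'))]
    rw [hav]
  · rw [rcWeightW_eq_zero_of_one_not_mem w q ∅ h1 he, zero_mul, zero_mul]

/-- Absorption for `a`. [cite: Grimmett2006, §1.4 eq. (1.20) (p. 15)] -/
theorem taaS_absorb (w : Sym2 V → unitInterval) (q : ℝ) (S : Set V) (y z x₀ v : V) (X : Set V) (hx₀ : x₀ ∈ X)
    (h1 : (w s(x₀, v) : ℝ) = 1) : taaS w q S y z (insert v X) = taaS w q S y z X := by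
  unfold taaS
  refine Finset.sum_congr rfl fun ω _ => ?_
  by_cases he : s(x₀, v) ∈ ω
  · have hω : insert s(x₀, v) ω = ω := Set.insert_eq_of_mem he
    have hx₀' : x₀ ∈ S ∪ X := Set.mem_union_right _ hx₀
    have hav : ω ∈ avoidEv y (S ∪ insert v X) ↔ ω ∈ avoidEv y (S ∪ X) := by
      rw [Set.union_insert]
      constructor
      · intro h; exact hω ▸ (insert_mem_avoidEv_iff y x₀ v (S ∪ X) hx₀' ω).2 h
      · intro h'; exact (insert_mem_avoidEv_iff y x₀ v (S ∪ X) hx₀' ω).1 (hω.symm ▸ h')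
    have hind : ind (avoidEv y (S ∪ insert v X) ∩ openConn y z) ω = ind (avoidEv y (S ∪ X) ∩ openConn y z) ω := by
      by_cases h : ω ∈ avoidEv y (S ∪ X) ∩ openConn y z
      · rw [ind_of_mem h, ind_of_mem (Set.mem_inter (hav.2 h.1) h.2)]
      · rw [ind_of_not_mem h, ind_of_not_mem fun h' => h (Set.mem_inter (hav.1 h'.1) h'.2)]
    rw [hind]
  · rw [rcWeightW_eq_zero_of_one_not_mem w q ∅ h1 he, zero_mul, zero_mul]

/-- **Section identity for `B` (random-cluster weights)**: along the pair `e = s(x₀,v)`, `x₀ ∈ X`,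
`B_X(w) = (1 − w e)·B_X(w[e↦0]) + (w e)·B_{X∪{v}}(w[e↦1])` — deletion and contraction of `e`.
(FK form of prove-5's `HullPort.taB_section`; bschramm/FK-Q2.md §12.2) [cite: Grimmett2006, Thm. (3.1)(a), eq. (1.20)] -/
theorem taBS_sectionFK (w : Sym2 V → unitInterval) (q : ℝ) (x : V) (S : Set V) (y x₀ v : V) (X : Set V) (hx₀ : x₀ ∈ X)
    (g : Set (Sym2 V) → ℝ) :
    taBS w q x S y X g = (1 - (w s(x₀, v) : ℝ)) * taBS (Function.update w s(x₀, v) 0) q x S y X g +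
      (w s(x₀, v) : ℝ) * taBS (Function.update w s(x₀, v) 1) q x S y (insert v X) g := by
  rw [taBS_absorb (Function.update w s(x₀, v) 1) q x S y x₀ v X hx₀ (by simp) g]
  unfold taBS
  rw [Finset.mul_sum, Finset.mul_sum, ← Finset.sum_add_distrib]
  refine Finset.sum_congr rfl fun ω _ => ?_
  rw [rcWeightW_affine w q ∅ s(x₀, v) ω,
    ← taCS_congr_off q x S y X g (update_eq_off_cut w x₀ v X hx₀ 0 ω),
    ← taCS_congr_off q x S y X g (update_eq_off_cut w x₀ v X hx₀ 1 ω)]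
  ring

/-- Section identity for `A` (random-cluster weights). [cite: Grimmett2006, Thm. (3.1)(a), eq. (1.20)] -/
theorem taAS_sectionFK (w : Sym2 V → unitInterval) (q : ℝ) (x : V) (S : Set V) (y z x₀ v : V) (X : Set V) (hx₀ : x₀ ∈ X)
    (g : Set (Sym2 V) → ℝ) :
    taAS w q x S y z X g = (1 - (w s(x₀, v) : ℝ)) * taAS (Function.update w s(x₀, v) 0) q x S y z X g +
      (w s(x₀, v) : ℝ) * taAS (Function.update w s(x₀, v) 1) q x S y z (insert v X) g := by
  rw [taAS_absorb (Function.update w s(x₀, v) 1) q x S y z x₀ v X hx₀ (by simp) g]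
  unfold taAS
  rw [Finset.mul_sum, Finset.mul_sum, ← Finset.sum_add_distrib]
  refine Finset.sum_congr rfl fun ω _ => ?_
  rw [rcWeightW_affine w q ∅ s(x₀, v) ω,
    ← taCS_congr_off q x S y X g (update_eq_off_cut w x₀ v X hx₀ 0 ω),
    ← taCS_congr_off q x S y X g (update_eq_off_cut w x₀ v X hx₀ 1 ω),
    ← taNS_congr_off q S y X (update_eq_off_cut w x₀ v X hx₀ 0 ω),
    ← taNS_congr_off q S y X (update_eq_off_cut w x₀ v X hx₀ 1 ω),
    ← taNWS_congr_off q S y z X (update_eq_off_cut w x₀ v X hx₀ 0 ω),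
    ← taNWS_congr_off q S y z X (update_eq_off_cut w x₀ v X hx₀ 1 ω)]
  ring

/-- Section identity for `b` (random-cluster weights). [cite: Grimmett2006, Thm. (3.1)(a), eq. (1.20)] -/
theorem tabS_sectionFK (w : Sym2 V → unitInterval) (q : ℝ) (S : Set V) (y x₀ v : V) (X : Set V) (hx₀ : x₀ ∈ X) :
    tabS w q S y X = (1 - (w s(x₀, v) : ℝ)) * tabS (Function.update w s(x₀, v) 0) q S y X +
      (w s(x₀, v) : ℝ) * tabS (Function.update w s(x₀, v) 1) q S y (insert v X) := by
  rw [tabS_absorb (Function.update w s(x₀, v) 1) q S y x₀ v X hx₀ (by simp)]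
  unfold tabS
  rw [Finset.mul_sum, Finset.mul_sum, ← Finset.sum_add_distrib]
  refine Finset.sum_congr rfl fun ω _ => ?_
  rw [rcWeightW_affine w q ∅ s(x₀, v) ω]
  ring

/-- Section identity for `a` (random-cluster weights). [cite: Grimmett2006, Thm. (3.1)(a), eq. (1.20)] -/
theorem taaS_sectionFK (w : Sym2 V → unitInterval) (q : ℝ) (S : Set V) (y z x₀ v : V) (X : Set V) (hx₀ : x₀ ∈ X) :
    taaS w q S y z X = (1 - (w s(x₀, v) : ℝ)) * taaS (Function.update w s(x₀, v) 0) q S y z X +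
      (w s(x₀, v) : ℝ) * taaS (Function.update w s(x₀, v) 1) q S y z (insert v X) := by
  rw [taaS_absorb (Function.update w s(x₀, v) 1) q S y z x₀ v X hx₀ (by simp)]
  unfold taaS
  rw [Finset.mul_sum, Finset.mul_sum, ← Finset.sum_add_distrib]
  refine Finset.sum_congr rfl fun ω _ => ?_
  rw [rcWeightW_affine w q ∅ s(x₀, v) ω]
  ring

end Summit.CriticalPhenomena.PercolationContinuityZ3.Theorems.FK

end
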